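import Summits.Ventures.DiscreteObjects.PP12.OrbitCountOrderThree

/-!
# Orbit structure of a line under a collineation of order 3, and the orbit-matrix (grouped) row/column identities (kernel)
Framing: lottery ticket; floor = certified bounds/negative ranges.

Cell pub-namedobj (venture DiscreteObjects), target (M), designs gen 13; continuation of `OrbitCountOrderThree` (plane-level
`λ = 1` identity `orbit_row_identity` for `σ³ = 1`). This file adds, for an arbitrary finite projective plane:
* orbit structure of a line: a non-fixed line meets every point orbit in at most two points (`card_orb3_inter_le_two`) and at
  most ONE orbit twice (`orb3_eq_of_two_le`); a non-fixed line through a fixed point meets every orbit at most once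
  (`card_orb3_inter_le_one_of_fixed_mem`); three collinear points of an orbit force a fixed line (`line_fixed_of_orbit_subset`);
* the fixed-point-free forms of the row identity (`orbit_row_identity_noFixed`, `orbit_row_identity_oneFixed`) and the count
  `card_common_orbits_eq_three`;
* the ORBIT-MATRIX forms **`orbit_row_identity_grouped`** / **`orbit_column_identity_grouped`**: for any system `Reps` of
  representatives of the non-trivial orbits, `3·#{fixed points on a ∩ b} + Σ_{r ∈ Reps} |orb3 r ∩ a|·|orb3 r ∩ b| = 3 + n·[a ∈ orb3 b]`
  — the `λ = 1` equation between two rows of the tactical decomposition of `⟨σ⟩`, index-free; every concrete reduction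
  (`FlagTenOrbitReduction`, `FlagSevenOrbitReduction`, FAMILY-FLAG7 §1 (R1)–(C6)) is this identity with `Reps` enumerated by the
  cell's indexing;
* a flag-type application valid for EVERY number `f` of fixed points: **`flag_tlines_common_orbits`** — two lines `≠ l` through
  different fixed points `y ≠ y'` (`≠ c`) of a flag-type collineation share exactly three non-trivial point orbits (= equation (R3)
  of designs g12 FAMILY-FLAG7 §1: `Σ_s |C_s ∩ C'_s| + #{j : β_kj(C) = β_k'j(C')} = 3`).
No `sorry`, no new axioms; nothing is specific to order 12.
-/

namespace Summit.Ventures.DiscreteObjects.PP12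

open Configuration Finset
open scoped Classical

section Perm

variable {α : Type*}

/-- `orb3` is constant along itself (`τ³ = 1`). -/
theorem orb3_eq_of_mem (τ : Equiv.Perm α) (h : τ ^ 3 = 1) {x y : α} (hy : y ∈ orb3 τ x) :
    orb3 τ y = orb3 τ x := by
  rw [mem_orb3] at hy
  ext z
  rw [mem_orb3, mem_orb3]
  have h3 := apply_three τ h x
  rcases hy with rfl | rfl | rfl
  · exact Iff.rfl
  · rw [h3]; tauto
  · rw [h3]; tauto

end Perm

namespace Collineation

variable {P L : Type*} [Membership P L] (σ : Collineation P L)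

/-! ### Orbit structure of a line (`σ³ = 1`; no finiteness needed) -/

/-- If an orbit meets the line `a` in at least two points, it contains a point `x` with `x, σx ∈ a` (`σ³ = 1`). -/
theorem exists_consecutive_of_two_le (hq : σ.onPoints ^ 3 = 1) {a : L} {q : P}
    (h2 : 2 ≤ ((orb3 σ.onPoints q).filter fun q' => q' ∈ a).card) :
    ∃ x ∈ orb3 σ.onPoints q, σ.onPoints x ≠ x ∧ x ∈ a ∧ σ.onPoints x ∈ a := by
  have hqf : σ.onPoints q ≠ q := by
    intro e; rw [orb3_of_fixed _ e] at h2
    have := (card_le_card (filter_subset (fun q' => q' ∈ a) ({q} : Finset P)))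
    rw [card_singleton] at this; omega
  have h3 := apply_three σ.onPoints hq q
  have hx1 : σ.onPoints (σ.onPoints q) ≠ σ.onPoints q := fun e => hqf (σ.onPoints.injective e)
  have hx2 : σ.onPoints (σ.onPoints (σ.onPoints q)) ≠ σ.onPoints (σ.onPoints q) := by
    rw [h3]; intro e; apply hqf
    have := congrArg σ.onPoints e; rw [h3] at this; exact this
  -- at most one of the three points is missing from a
  set S := (orb3 σ.onPoints q).filter fun q' => q' ∈ a with hS
  have memS : ∀ y, y ∈ S ↔ (y = q ∨ y = σ.onPoints q ∨ y = σ.onPoints (σ.onPoints q)) ∧ y ∈ a := fun y => by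
    rw [hS, mem_filter, mem_orb3]
  by_cases hq0 : q ∈ a
  · by_cases hq1 : σ.onPoints q ∈ a
    · exact ⟨q, self_mem_orb3 _ _, hqf, hq0, hq1⟩
    · by_cases hq2' : σ.onPoints (σ.onPoints q) ∈ a
      · exact ⟨σ.onPoints (σ.onPoints q), (mem_orb3 _ _ _).2 (Or.inr (Or.inr rfl)), hx2, hq2', by rw [h3]; exact hq0⟩
      · exfalso
        have hsub : S ⊆ {q} := fun y hy => by
          rw [memS] at hy; rw [mem_singleton]
          rcases hy.1 with rfl | rfl | rfl
          · rfl
          · exact absurd hy.2 hq1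
          · exact absurd hy.2 hq2'
        have := card_le_card hsub; rw [card_singleton] at this; omega
  · by_cases hq1 : σ.onPoints q ∈ a
    · by_cases hq2' : σ.onPoints (σ.onPoints q) ∈ a
      · exact ⟨σ.onPoints q, (mem_orb3 _ _ _).2 (Or.inr (Or.inl rfl)), hx1, hq1, hq2'⟩
      · exfalso
        have hsub : S ⊆ {σ.onPoints q} := fun y hy => by
          rw [memS] at hy; rw [mem_singleton]
          rcases hy.1 with rfl | rfl | rfl
          · exact absurd hy.2 hq0
          · rfl
          · exact absurd hy.2 hq2'
        have := card_le_card hsub; rw [card_singleton] at this; omega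
    · exfalso
      have hsub : S ⊆ {σ.onPoints (σ.onPoints q)} := fun y hy => by
        rw [memS] at hy; rw [mem_singleton]
        rcases hy.1 with rfl | rfl | rfl
        · exact absurd hy.2 hq0
        · exact absurd hy.2 hq1
        · rfl
      have := card_le_card hsub; rw [card_singleton] at this; omega

section Plane

variable [ProjectivePlane P L]

/-- **Three collinear points of one orbit force a fixed line:** if `q, σq, σ²q` all lie on `a` (`q` not fixed), then `σ a = a`. -/
theorem line_fixed_of_orbit_subset {q : P} (hqf : σ.onPoints q ≠ q) {a : L}
    (h0 : q ∈ a) (h1 : σ.onPoints q ∈ a) (h2 : σ.onPoints (σ.onPoints q) ∈ a) : σ.onLines a = a := by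
  have hne : σ.onPoints q ≠ σ.onPoints (σ.onPoints q) := fun e => hqf (σ.onPoints.injective e).symm
  have h1' : σ.onPoints q ∈ σ.onLines a := σ.mem_map h0
  have h2' : σ.onPoints (σ.onPoints q) ∈ σ.onLines a := σ.mem_map h1
  exact ((Nondegenerate.eq_or_eq h1 h2 h1' h2').resolve_left hne).symm

/-- **A non-fixed line meets every orbit in at most two points.** -/
theorem card_orb3_inter_le_two (hq : σ.onPoints ^ 3 = 1) {a : L} (ha : σ.onLines a ≠ a) (q : P) :
    ((orb3 σ.onPoints q).filter fun q' => q' ∈ a).card ≤ 2 := by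
  by_cases hqf : σ.onPoints q = q
  · rw [orb3_of_fixed _ hqf]
    exact (card_le_card (filter_subset _ _)).trans (by simp)
  · by_contra hlt
    have h3 : (orb3 σ.onPoints q).card = 3 := card_orb3_of_ne _ hq hqf
    have hall : (orb3 σ.onPoints q).filter (fun q' => q' ∈ a) = orb3 σ.onPoints q :=
      Finset.eq_of_subset_of_card_le (filter_subset _ _) (by rw [h3]; omega)
    have hmem : ∀ q' ∈ orb3 σ.onPoints q, q' ∈ a := fun q' hq' => by
      have : q' ∈ (orb3 σ.onPoints q).filter (fun q' => q' ∈ a) := by rw [hall]; exact hq'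
      exact (mem_filter.1 this).2
    apply ha
    exact σ.line_fixed_of_orbit_subset hqf (hmem _ (self_mem_orb3 _ _))
      (hmem _ ((mem_orb3 _ _ _).2 (Or.inr (Or.inl rfl)))) (hmem _ ((mem_orb3 _ _ _).2 (Or.inr (Or.inr rfl))))

/-- **A non-fixed line meets at most one orbit twice** (`σ³ = 1`): two orbits each meeting `a` in two points coincide. -/
theorem orb3_eq_of_two_le (hq : σ.onPoints ^ 3 = 1) {a : L} (ha : σ.onLines a ≠ a) {q r : P}
    (h2q : 2 ≤ ((orb3 σ.onPoints q).filter fun q' => q' ∈ a).card)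
    (h2r : 2 ≤ ((orb3 σ.onPoints r).filter fun q' => q' ∈ a).card) : orb3 σ.onPoints q = orb3 σ.onPoints r := by
  obtain ⟨x, hx, -, hxa, hσxa⟩ := σ.exists_consecutive_of_two_le hq h2q
  obtain ⟨y, hy, -, hya, hσya⟩ := σ.exists_consecutive_of_two_le hq h2r
  have hxy : x = y := by
    by_contra hne
    have hne' : σ.onPoints x ≠ σ.onPoints y := fun e => hne (σ.onPoints.injective e)
    exact ha ((Nondegenerate.eq_or_eq hσxa hσya (σ.mem_map hxa) (σ.mem_map hya)).resolve_left hne').symm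
  rw [← orb3_eq_of_mem _ hq hx, ← orb3_eq_of_mem _ hq hy, hxy]

/-- **A non-fixed line through a fixed point meets every orbit in at most one point** (`σ³ = 1`). -/
theorem card_orb3_inter_le_one_of_fixed_mem (hq : σ.onPoints ^ 3 = 1) {a : L} (ha : σ.onLines a ≠ a) {y : P}
    (hy : σ.onPoints y = y) (hya : y ∈ a) (q : P) : ((orb3 σ.onPoints q).filter fun q' => q' ∈ a).card ≤ 1 := by
  by_contra hlt
  obtain ⟨x, -, hxf, hxa, hσxa⟩ := σ.exists_consecutive_of_two_le hq (a := a) (q := q) (by omega)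
  have hne : σ.onPoints x ≠ y := by
    intro e; apply hxf
    have : σ.onPoints (σ.onPoints x) = σ.onPoints x := by rw [e, hy]
    exact σ.onPoints.injective this
  have hyσa : y ∈ σ.onLines a := by have := σ.mem_map hya; rwa [hy] at this
  exact ha ((Nondegenerate.eq_or_eq hσxa hya (σ.mem_map hxa) hyσa).resolve_left hne).symm

end Plane

variable [ProjectivePlane P L] [Fintype P] [Fintype L]

/-- **Row identity for a line without fixed points** (e.g. an exterior line / side): for `σ³ = 1`, `σ b ≠ b`, `a` free of fixed
points: `Σ_{q ∈ a} |orb3 q ∩ b| = n + 3` if `a ∈ {b, σb, σ²b}`, else `3`. -/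
theorem orbit_row_identity_noFixed (hq : σ.onPoints ^ 3 = 1) {b : L} (hb : σ.onLines b ≠ b) {a : L}
    (ha : ∀ q : P, q ∈ a → σ.onPoints q ≠ q) :
    ∑ q ∈ univ.filter (fun q : P => q ∈ a), ((orb3 σ.onPoints q).filter fun q' => q' ∈ b).card
      = if a ∈ orb3 σ.onLines b then ProjectivePlane.order P L + 3 else 3 := by
  rw [← σ.orbit_row_identity hq hb a]
  refine Finset.sum_congr rfl fun q hqa => ?_
  rw [mem_filter] at hqa
  unfold orbWeight; rw [if_neg (ha q hqa.2)]

/-- **Row identity for a line whose only fixed point is `y ∉ b`** (e.g. a non-fixed line through a fixed point of a flag-type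
collineation, against a line of another such orbit): the fixed-point term vanishes and `Σ_{q ∈ a, σq ≠ q} |orb3 q ∩ b| = 3`. -/
theorem orbit_row_identity_oneFixed (hq : σ.onPoints ^ 3 = 1) {b : L} (hb : σ.onLines b ≠ b) {a : L} {y : P}
    (hy : ∀ q : P, q ∈ a → σ.onPoints q = q → q = y) (hyb : y ∉ b) (hab : a ∉ orb3 σ.onLines b) :
    ∑ q ∈ univ.filter (fun q : P => q ∈ a ∧ σ.onPoints q ≠ q), ((orb3 σ.onPoints q).filter fun q' => q' ∈ b).card = 3 := by
  have h := σ.orbit_row_identity_of_not_mem hq hb hab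
  rw [← Finset.sum_filter_add_sum_filter_not (univ.filter fun q : P => q ∈ a) (fun q => σ.onPoints q = q)] at h
  have hfix : ∑ q ∈ (univ.filter fun q : P => q ∈ a).filter (fun q => σ.onPoints q = q), σ.orbWeight b q = 0 := by
    refine Finset.sum_eq_zero fun q hq' => ?_
    rw [mem_filter, mem_filter] at hq'
    have hqy : q = y := hy q hq'.1.2 hq'.2
    unfold orbWeight; rw [if_pos hq'.2, if_neg (by rw [hqy]; exact hyb)]
  rw [hfix, zero_add, Finset.filter_filter] at h
  rw [← h]
  refine Finset.sum_congr rfl fun q hq' => ?_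
  rw [mem_filter] at hq'
  unfold orbWeight; rw [if_neg hq'.2.2]

/-- **Three common orbits.** Under the hypotheses of `orbit_row_identity_oneFixed`, if moreover `b` meets every orbit in at most
one point (e.g. `b` also passes through a fixed point, `card_orb3_inter_le_one_of_fixed_mem`), then exactly THREE of the orbits of
the non-fixed points of `a` meet `b` — the plane-level form of equation (R3) of FAMILY-FLAG7 §1 (two T-line orbits through different
fixed points share `|C ∩ C'| + #{j : β agree} = 3` orbits). -/
theorem card_common_orbits_eq_three (hq : σ.onPoints ^ 3 = 1) {b : L} (hb : σ.onLines b ≠ b) {a : L} {y : P}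
    (hy : ∀ q : P, q ∈ a → σ.onPoints q = q → q = y) (hyb : y ∉ b) (hab : a ∉ orb3 σ.onLines b)
    (hb1 : ∀ q : P, ((orb3 σ.onPoints q).filter fun q' => q' ∈ b).card ≤ 1) :
    (univ.filter fun q : P => q ∈ a ∧ σ.onPoints q ≠ q ∧ ∃ q' ∈ orb3 σ.onPoints q, q' ∈ b).card = 3 := by
  have h := σ.orbit_row_identity_oneFixed hq hb hy hyb hab
  -- each summand is 0 or 1; the sum counts the nonzero ones
  have h01 : ∀ q : P, ((orb3 σ.onPoints q).filter fun q' => q' ∈ b).card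
      = if ∃ q' ∈ orb3 σ.onPoints q, q' ∈ b then 1 else 0 := by
    intro q
    split_ifs with hex
    · obtain ⟨q', hq', hq'b⟩ := hex
      have hpos : 0 < ((orb3 σ.onPoints q).filter fun q' => q' ∈ b).card :=
        card_pos.2 ⟨q', mem_filter.2 ⟨hq', hq'b⟩⟩
      have := hb1 q; omega
    · rw [card_eq_zero, filter_eq_empty_iff]
      exact fun q' hq' hq'b => hex ⟨q', hq', hq'b⟩
  simp only [h01] at h
  rw [Finset.sum_boole] at h
  rw [Finset.filter_filter] at h
  have : (univ.filter fun q : P => (q ∈ a ∧ σ.onPoints q ≠ q) ∧ ∃ q' ∈ orb3 σ.onPoints q, q' ∈ b)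
      = univ.filter fun q : P => q ∈ a ∧ σ.onPoints q ≠ q ∧ ∃ q' ∈ orb3 σ.onPoints q, q' ∈ b := by
    ext q; simp only [mem_filter, mem_univ, true_and, and_assoc]
  rw [this] at h
  exact_mod_cast h

/-! ### The row identity grouped by point orbits (the orbit-matrix form `Σ_P M_{aP} M_{bP} + 3·(fixed) = 3 + n[a ∈ B]`) -/

/-- **Orbit-matrix row identity.** Let `Reps` be a system of representatives of the non-trivial point orbits of `σ` (`σ³ = 1`):
the orbits `orb3 r`, `r ∈ Reps`, are pairwise disjoint, consist of non-fixed points, and cover every non-fixed point. Then for a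
non-fixed line `b` and any line `a`:
`3 · #{q ∈ a ∩ b : σq = q} + Σ_{r ∈ Reps} |orb3 r ∩ a| · |orb3 r ∩ b| = 3 + n · [a ∈ orb3 b]`.
With `M_{a,r} := |orb3 r ∩ a|` (independent of the line within its orbit, `card_filter_mem_mapLine`) this is the `λ = 1` row equation
of the orbit matrix (tactical decomposition) of `⟨σ⟩`; every concrete reduction (e.g. FAMILY-FLAG7 §1 (R1)–(R3)) is this identity with
`Reps` enumerated by the cell's indexing. -/
theorem orbit_row_identity_grouped (hq : σ.onPoints ^ 3 = 1) {b : L} (hb : σ.onLines b ≠ b) (a : L) (Reps : Finset P)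
    (hnf : ∀ r ∈ Reps, σ.onPoints r ≠ r)
    (hdisj : ∀ r ∈ Reps, ∀ r' ∈ Reps, r ≠ r' → Disjoint (orb3 σ.onPoints r) (orb3 σ.onPoints r'))
    (hcover : ∀ q : P, σ.onPoints q ≠ q → ∃ r ∈ Reps, q ∈ orb3 σ.onPoints r) :
    3 * (univ.filter fun q : P => q ∈ a ∧ q ∈ b ∧ σ.onPoints q = q).card
      + ∑ r ∈ Reps, ((orb3 σ.onPoints r).filter fun q => q ∈ a).card * ((orb3 σ.onPoints r).filter fun q => q ∈ b).card
      = if a ∈ orb3 σ.onLines b then ProjectivePlane.order P L + 3 else 3 := by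
  rw [← σ.orbit_row_identity hq hb a,
    ← Finset.sum_filter_add_sum_filter_not (univ.filter fun q : P => q ∈ a) (fun q => σ.onPoints q = q)]
  congr 1
  · -- fixed points: weight 3·[q ∈ b]
    rw [Finset.filter_filter, Finset.card_eq_sum_ones, Finset.mul_sum]
    rw [show (univ.filter fun q : P => q ∈ a ∧ q ∈ b ∧ σ.onPoints q = q)
        = (univ.filter fun q : P => q ∈ a ∧ σ.onPoints q = q).filter (fun q => q ∈ b) by
          ext q; simp only [mem_filter, mem_univ, true_and]; tauto]
    rw [Finset.sum_filter]
    refine Finset.sum_congr rfl fun q hq' => ?_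
    rw [mem_filter] at hq'
    unfold orbWeight; rw [if_pos hq'.2.2]; split_ifs <;> simp
  · -- non-fixed points, grouped by orbit
    have hset : (univ.filter fun q : P => q ∈ a).filter (fun q => ¬ σ.onPoints q = q)
        = Reps.biUnion (fun r => (orb3 σ.onPoints r).filter fun q => q ∈ a) := by
      ext q
      simp only [mem_filter, mem_univ, true_and, mem_biUnion]
      constructor
      · rintro ⟨hqa, hqf⟩
        obtain ⟨r, hr, hqr⟩ := hcover q hqf
        exact ⟨r, hr, hqr, hqa⟩
      · rintro ⟨r, hr, hqr, hqa⟩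
        refine ⟨hqa, fun hqf => hnf r hr ?_⟩
        -- q fixed and q ∈ orb3 r ⇒ r fixed
        have e := orb3_eq_of_mem σ.onPoints hq hqr
        rw [orb3_of_fixed _ hqf] at e
        have : r ∈ ({q} : Finset P) := by rw [e]; exact self_mem_orb3 _ _
        rw [mem_singleton] at this; rw [this]; exact hqf
    rw [hset, Finset.sum_biUnion]
    · refine Finset.sum_congr rfl fun r hr => ?_
      rw [Finset.card_eq_sum_ones ((orb3 σ.onPoints r).filter fun q => q ∈ a), Finset.sum_mul]
      refine Finset.sum_congr rfl fun q hq' => ?_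
      rw [mem_filter] at hq'
      have hqf : σ.onPoints q ≠ q := by
        intro e
        have e2 := orb3_eq_of_mem σ.onPoints hq hq'.1
        rw [orb3_of_fixed _ e] at e2
        have : r ∈ ({q} : Finset P) := by rw [e2]; exact self_mem_orb3 _ _
        rw [mem_singleton] at this
        exact hnf r hr (by rw [this]; exact e)
      unfold orbWeight; rw [if_neg hqf, one_mul, orb3_eq_of_mem σ.onPoints hq hq'.1]
    · -- pairwise disjointness of the pieces
      intro r hr r' hr' hne
      exact Finset.disjoint_filter_filter ((hdisj r hr r' hr' hne))

/-- **Orbit-matrix column identity** (dual of `orbit_row_identity_grouped`): for a system `RepsL` of representatives of the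
non-trivial LINE orbits, a non-fixed point `p` and any point `q`:
`3 · #{m : q, p ∈ m, σm = m} + Σ_{m ∈ RepsL} #{m' ∈ orb3 m : q ∈ m'} · #{m' ∈ orb3 m : p ∈ m'} = 3 + n · [q ∈ orb3 p]`. -/
theorem orbit_column_identity_grouped (hq : σ.onPoints ^ 3 = 1) {p : P} (hp : σ.onPoints p ≠ p) (q : P) (RepsL : Finset L)
    (hnf : ∀ m ∈ RepsL, σ.onLines m ≠ m)
    (hdisj : ∀ m ∈ RepsL, ∀ m' ∈ RepsL, m ≠ m' → Disjoint (orb3 σ.onLines m) (orb3 σ.onLines m'))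
    (hcover : ∀ m : L, σ.onLines m ≠ m → ∃ r ∈ RepsL, m ∈ orb3 σ.onLines r) :
    3 * (univ.filter fun m : L => q ∈ m ∧ p ∈ m ∧ σ.onLines m = m).card
      + ∑ r ∈ RepsL, ((orb3 σ.onLines r).filter fun m => q ∈ m).card * ((orb3 σ.onLines r).filter fun m => p ∈ m).card
      = if q ∈ orb3 σ.onPoints p then ProjectivePlane.order P L + 3 else 3 := by
  have hqL : σ.onLines ^ 3 = 1 := σ.onLines_pow_eq_one hq
  have h := σ.dual.orbit_row_identity_grouped (a := (q : Dual P)) (b := (p : Dual P)) hqL hp (RepsL : Finset (Dual L))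
    hnf hdisj hcover
  rw [ProjectivePlane.Dual.order] at h
  exact h

/-! ### A flag-type consequence: equation (R3) of FAMILY-FLAG7 §1 at plane level, for every `f` -/

/-- **Two non-fixed lines through different fixed points of a flag-type collineation share exactly three non-trivial point
orbits.** Setting: `σ³ = 1`; all fixed points lie on the fixed line `l`; all fixed lines pass through the fixed point `c ∈ l`
(flag type, any number `f` of fixed points); `y ≠ y'` fixed points different from `c`; `a ∋ y` and `b ∋ y'` lines different
from `l`. Then exactly three of the orbits of the non-fixed points of `a` meet `b`. (In the orbit matrix: the T-line orbits
`(k, C)` and `(k', C')`, `k ≠ k'`, satisfy `Σ_s |C_s ∩ C'_s| + #{j : β_kj(C) = β_k'j(C')} = 3`.) -/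
theorem flag_tlines_common_orbits (hq : σ.onPoints ^ 3 = 1) {l : L} {c : P} (hcl : c ∈ l)
    (hP : ∀ x : P, σ.onPoints x = x → x ∈ l) (hL : ∀ m : L, σ.onLines m = m → c ∈ m)
    {y y' : P} (hy : σ.onPoints y = y) (hy' : σ.onPoints y' = y') (hyy' : y ≠ y') (hyc : y ≠ c) (hy'c : y' ≠ c)
    {a b : L} (hya : y ∈ a) (hal : a ≠ l) (hy'b : y' ∈ b) (hbl : b ≠ l) :
    (univ.filter fun q : P => q ∈ a ∧ σ.onPoints q ≠ q ∧ ∃ q' ∈ orb3 σ.onPoints q, q' ∈ b).card = 3 := by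
  have hyl : y ∈ l := hP y hy
  have hy'l : y' ∈ l := hP y' hy'
  -- a and b are not fixed (a fixed line through y ≠ c would contain c and y, hence be l)
  have hna : σ.onLines a ≠ a := fun h =>
    hal ((Nondegenerate.eq_or_eq (hL a h) hya hcl hyl).resolve_left hyc.symm)
  have hnb : σ.onLines b ≠ b := fun h =>
    hbl ((Nondegenerate.eq_or_eq (hL b h) hy'b hcl hy'l).resolve_left hy'c.symm)
  -- the only fixed point of a is y
  have hfix : ∀ q : P, q ∈ a → σ.onPoints q = q → q = y := fun q hqa hqf =>
    (Nondegenerate.eq_or_eq hqa hya (hP q hqf) hyl).resolve_right hal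
  -- y ∉ b and a ∉ orbit(b) (every line of the orbit of b passes through y')
  have hyb : y ∉ b := fun h => hbl ((Nondegenerate.eq_or_eq h hy'b hyl hy'l).resolve_left hyy')
  have hy'σ : ∀ m : L, y' ∈ m → y' ∈ σ.onLines m := fun m hm => by
    have := σ.mem_map hm; rwa [hy'] at this
  have hab : a ∉ orb3 σ.onLines b := by
    intro h
    have hy'a : y' ∈ a := by
      rw [mem_orb3] at h
      rcases h with rfl | rfl | rfl
      · exact hy'b
      · exact hy'σ _ hy'b
      · exact hy'σ _ (hy'σ _ hy'b)
    exact hal ((Nondegenerate.eq_or_eq hya hy'a hyl hy'l).resolve_left hyy')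
  exact σ.card_common_orbits_eq_three hq hnb hfix hyb hab
    (σ.card_orb3_inter_le_one_of_fixed_mem hq hnb hy' hy'b)

end Collineation

end Summit.Ventures.DiscreteObjects.PP12
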